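import Summits.NavierStokesRegularity.NavierStokesRegularity.Theorems.RellichScarScarRigidityVorticityDefectKinematics
import Summits.NavierStokesRegularity.NavierStokesRegularity.Theorems.RellichScarScarRigidityLogConvexityGreen
import HarnessLib

/-!
# `ScarRigidity`, line `moment-conditioned-rellich` — stub `stub_vorticityDefectDecay` (V-rung), part 4:
# integrations by parts on a fixed slice — the first moments of `A_ij[G]` vanish

Crux stmt-NavierStokesRegularity-11717 (route RellichScar), helper file (`--supports`) for `stub_vorticityDefectDecay`.
On a slice `t < 0` the defect source `G = Δw − ((w·∇)V₁ + (V₂·∇)w)` of the twins is, componentwise, a DIVERGENCE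
`G_j = div(∇w_j) − div((V₁)_j w) − div(w_j V₂)` (`div w = div V₂ = 0`) of fields `O((‖y‖+√(−t))⁻⁴)` with divergences
`O((‖y‖+√(−t))⁻⁵)`, so `∫ G_j = 0` (`integral_defectSource_coord_eq_zero`); one more integration by parts,
`∫ y_m ∂ᵢG_j = −δ_{mi} ∫ G_j`, gives **`∫ y_m A_ij[G(t)](y) dy = 0`** (`integral_coord_mul_antisymGrad_defectSource`):
the rate of the first moments of the antisymmetric gradient vanishes — momentum conservation WITHOUT the pressure.
-/

noncomputable section

open Set Filter Function MeasureTheory Metric TopologicalSpace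
open scoped Topology ContDiff Laplacian InnerProductSpace RealInnerProductSpace
open Literature.Analysis.FluidPDE

set_option linter.dupNamespace false -- D-0017: `Summit.<S>.<S>.…` repeats the summit name by design
set_option maxSynthPendingDepth 4

namespace Summit.NavierStokesRegularity.NavierStokesRegularity.Theorems.RellichScarScarRigidity

/-- **Integrability on `ℝ³` from a majorant `C/(‖y‖+a)ᵖ`, `a > 0`, `p ≥ 4`** (comparison with
`(1+‖y‖)⁻ᵖ`, Mathlib `integrable_one_add_norm`). [folklore] -/
theorem integrable_of_norm_le_apexWeight {E' : Type*} [NormedAddCommGroup E'] {f : EuclideanSpace ℝ (Fin 3) → E'}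
    (hf : AEStronglyMeasurable f volume) {a C : ℝ} (ha : 0 < a) {p : ℕ} (hp : 4 ≤ p)
    (h : ∀ y, ‖f y‖ ≤ C / (‖y‖ + a) ^ p) : Integrable f volume := by
  have hm : 0 < min 1 a := lt_min one_pos ha
  have hC : 0 ≤ C := by
    by_contra hC
    have h0 := (norm_nonneg _).trans (h 0)
    rw [norm_zero, zero_add] at h0
    linarith [div_neg_of_neg_of_pos (not_le.1 hC) (pow_pos ha p)]
  have hr : (Module.finrank ℝ (EuclideanSpace ℝ (Fin 3)) : ℝ) < (p : ℝ) := by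
    rw [finrank_euclideanSpace, Fintype.card_fin]; exact_mod_cast hp
  refine ((integrable_one_add_norm hr).const_mul (C * ((min 1 a)⁻¹) ^ p)).mono' hf
    (Eventually.of_forall fun y => (h y).trans ?_)
  have hy1 : 0 < 1 + ‖y‖ := by positivity
  have hle : min 1 a * (1 + ‖y‖) ≤ ‖y‖ + a := by
    nlinarith [min_le_left 1 a, min_le_right 1 a, norm_nonneg y]
  have hpow : (min 1 a * (1 + ‖y‖)) ^ p ≤ (‖y‖ + a) ^ p := pow_le_pow_left₀ (by positivity) hle p
  rw [Real.rpow_neg hy1.le, Real.rpow_natCast, mul_assoc, div_eq_mul_inv]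
  refine mul_le_mul_of_nonneg_left ?_ hC
  calc ((‖y‖ + a) ^ p)⁻¹ ≤ ((min 1 a * (1 + ‖y‖)) ^ p)⁻¹ := inv_anti₀ (by positivity) hpow
    _ = ((min 1 a)⁻¹) ^ p * ((1 + ‖y‖) ^ p)⁻¹ := by rw [mul_pow, mul_inv, inv_pow]

/-- The first-moment weight costs one power: `‖y‖·X/(‖y‖+a)^{p+1} ≤ X/(‖y‖+a)ᵖ` (`X ≥ 0`, `a > 0`). [folklore] -/
theorem norm_mul_div_apexWeight_succ_le {a X : ℝ} (ha : 0 < a) (hX : 0 ≤ X) (p : ℕ) (y : EuclideanSpace ℝ (Fin 3)) :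
    ‖y‖ * (X / (‖y‖ + a) ^ (p + 1)) ≤ X / (‖y‖ + a) ^ p := by
  have hρ : 0 < ‖y‖ + a := by positivity
  have h1 : ‖y‖ / (‖y‖ + a) ≤ 1 := (div_le_one hρ).2 (by linarith)
  calc ‖y‖ * (X / (‖y‖ + a) ^ (p + 1)) = ‖y‖ / (‖y‖ + a) * (X / (‖y‖ + a) ^ p) := by
        rw [pow_succ]
        field_simp
    _ ≤ 1 * (X / (‖y‖ + a) ^ p) := mul_le_mul_of_nonneg_right h1 (div_nonneg hX (pow_nonneg hρ.le _))
    _ = X / (‖y‖ + a) ^ p := one_mul _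

/-- Components of the Fréchet derivative: `(Dw(y) a)ᵢ = D(wᵢ)(y) a`. [folklore] -/
theorem fderiv_apply_coord_eq {w : EuclideanSpace ℝ (Fin 3) → EuclideanSpace ℝ (Fin 3)} {y : EuclideanSpace ℝ (Fin 3)} (hw : DifferentiableAt ℝ w y) (a : EuclideanSpace ℝ (Fin 3)) (i : Fin 3) :
    (fderiv ℝ w y a) i = fderiv ℝ (fun z => w z i) y a := by
  have h : (fun z => w z i) = (EuclideanSpace.proj i : EuclideanSpace ℝ (Fin 3) →L[ℝ] ℝ) ∘ w := rfl
  rw [h, ((EuclideanSpace.proj i : EuclideanSpace ℝ (Fin 3) →L[ℝ] ℝ).hasFDerivAt.comp y hw.hasFDerivAt).fderiv]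
  rfl

/-- The coordinate function `y ↦ y_m` has derivative `a ↦ a_m`. [folklore] -/
theorem hasFDerivAt_euclidean_coord (m : Fin 3) (y : EuclideanSpace ℝ (Fin 3)) :
    HasFDerivAt (fun z : EuclideanSpace ℝ (Fin 3) => z m) (EuclideanSpace.proj m : EuclideanSpace ℝ (Fin 3) →L[ℝ] ℝ) y :=
  (EuclideanSpace.proj m : EuclideanSpace ℝ (Fin 3) →L[ℝ] ℝ).hasFDerivAt

/-- **`∫ y_m ∂ᵢg = −δ_{mi} ∫ g`** on `ℝ³` for `g ∈ C¹` with `g`, `y_m g`, `y_m ∂ᵢg ∈ L¹` (no boundary terms for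
the integrable `C¹` function `y_m g`, whose `∂ᵢ` is `δ_{mi} g + y_m ∂ᵢg`). [folklore] -/
theorem integral_coord_mul_fderiv_apply {g : EuclideanSpace ℝ (Fin 3) → ℝ} (hg : ContDiff ℝ 1 g) (m i : Fin 3)
    (hint : Integrable g volume) (hm : Integrable (fun y : EuclideanSpace ℝ (Fin 3) => y m * g y) volume)
    (hd : Integrable (fun y : EuclideanSpace ℝ (Fin 3) => y m * fderiv ℝ g y (EuclideanSpace.single i (1 : ℝ))) volume) :
    ∫ y : EuclideanSpace ℝ (Fin 3), y m * fderiv ℝ g y (EuclideanSpace.single i (1 : ℝ)) = -((EuclideanSpace.single i (1 : ℝ) : EuclideanSpace ℝ (Fin 3)) m * ∫ y, g y) := by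
  have hH : ContDiff ℝ 1 fun y : EuclideanSpace ℝ (Fin 3) => y m * g y := (EuclideanSpace.proj m : EuclideanSpace ℝ (Fin 3) →L[ℝ] ℝ).contDiff.mul hg
  have hHd : ∀ y : EuclideanSpace ℝ (Fin 3), fderiv ℝ (fun y : EuclideanSpace ℝ (Fin 3) => y m * g y) y (EuclideanSpace.single i (1 : ℝ)) =
      (EuclideanSpace.single i (1 : ℝ) : EuclideanSpace ℝ (Fin 3)) m * g y + y m * fderiv ℝ g y (EuclideanSpace.single i (1 : ℝ)) := by
    intro y
    have hgd : DifferentiableAt ℝ g y := hg.differentiable one_ne_zero y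
    rw [fderiv_fun_mul (hasFDerivAt_euclidean_coord m y).differentiableAt hgd, (hasFDerivAt_euclidean_coord m y).fderiv]
    show y m * fderiv ℝ g y (EuclideanSpace.single i (1 : ℝ)) + g y * (EuclideanSpace.single i (1 : ℝ) : EuclideanSpace ℝ (Fin 3)) m = _
    ring
  have h0 := integral_fderiv_apply_eq_zero_of_integrable hH (EuclideanSpace.single i (1 : ℝ)) hm (by simp_rw [hHd]; exact (hint.const_mul _).add hd)
  simp_rw [hHd] at h0
  rw [integral_add (hint.const_mul _) hd, integral_const_mul] at h0
  linarith

/-! ### The components of the defect source are divergences -/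

section Divergence

variable {w V₁ V₂ : EuclideanSpace ℝ (Fin 3) → EuclideanSpace ℝ (Fin 3)}

/-- `(Δw)_j = Δ(w_j) = div(∇w_j)` for smooth `w`. [folklore] -/
theorem laplacian_coord_eq_divergence_gradient (hw : ContDiff ℝ ∞ w) (j : Fin 3) (y : EuclideanSpace ℝ (Fin 3)) :
    (Δ w y) j = VectorCalculus.divergence (gradient fun z => w z j) y := by
  have hw2 : ContDiff ℝ 2 w := hw.of_le (by norm_cast)
  have hwj : ContDiff ℝ 2 fun z => w z j := (EuclideanSpace.proj j : EuclideanSpace ℝ (Fin 3) →L[ℝ] ℝ).contDiff.comp hw2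
  rw [divergence_gradient hwj y]
  have h := ContDiffAt.laplacian_CLM_comp_left (l := (EuclideanSpace.proj j : EuclideanSpace ℝ (Fin 3) →L[ℝ] ℝ)) (hw2.contDiffAt (x := y))
  rw [show (fun z => w z j) = (EuclideanSpace.proj j : EuclideanSpace ℝ (Fin 3) →L[ℝ] ℝ) ∘ w from rfl, h]
  rfl

/-- `((w·∇)V₁)_j = div((V₁)_j w)` for a divergence-free `w`. [folklore] -/
theorem convect_coord_eq_divergence_smul (hw : ContDiff ℝ ∞ w) (hV₁ : ContDiff ℝ ∞ V₁)
    (hdiv : VectorCalculus.IsDivFree w) (j : Fin 3) (y : EuclideanSpace ℝ (Fin 3)) :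
    (convect w V₁ y) j = VectorCalculus.divergence (fun z => V₁ z j • w z) y := by
  have hθ : DifferentiableAt ℝ (fun z => V₁ z j) y :=
    (((EuclideanSpace.proj j : EuclideanSpace ℝ (Fin 3) →L[ℝ] ℝ).contDiff.comp hV₁).differentiable (by simp)) y
  rw [divergence_smul_apply hθ (hw.differentiable (by simp) y), hdiv y, mul_zero, zero_add, convect_apply,
    fderiv_apply_coord_eq (hV₁.differentiable (by simp) y), gradient, real_inner_comm,
    InnerProductSpace.toDual_symm_apply]

/-- `((V₂·∇)w)_j = div(w_j V₂)` for a divergence-free `V₂`. [folklore] -/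
theorem convect_coord_eq_divergence_smul' (hw : ContDiff ℝ ∞ w) (hV₂ : ContDiff ℝ ∞ V₂)
    (hdiv : VectorCalculus.IsDivFree V₂) (j : Fin 3) (y : EuclideanSpace ℝ (Fin 3)) :
    (convect V₂ w y) j = VectorCalculus.divergence (fun z => w z j • V₂ z) y := by
  have hθ : DifferentiableAt ℝ (fun z => w z j) y :=
    (((EuclideanSpace.proj j : EuclideanSpace ℝ (Fin 3) →L[ℝ] ℝ).contDiff.comp hw).differentiable (by simp)) y
  rw [divergence_smul_apply hθ (hV₂.differentiable (by simp) y), hdiv y, mul_zero, zero_add, convect_apply,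
    fderiv_apply_coord_eq (hw.differentiable (by simp) y), gradient, real_inner_comm,
    InnerProductSpace.toDual_symm_apply]

/-- `‖D(w_j)(y)‖ ≤ ‖Dw(y)‖` (the coordinate form has norm `≤ 1`). [folklore] -/
theorem norm_fderiv_coord_le_opNorm {w : EuclideanSpace ℝ (Fin 3) → EuclideanSpace ℝ (Fin 3)} {y : EuclideanSpace ℝ (Fin 3)}
    (hw : DifferentiableAt ℝ w y) (j : Fin 3) :
    ‖fderiv ℝ (fun z => w z j) y‖ ≤ ‖fderiv ℝ w y‖ := by
  have h : (fun z => w z j) = (EuclideanSpace.proj j : EuclideanSpace ℝ (Fin 3) →L[ℝ] ℝ) ∘ w := rfl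
  rw [h, ((EuclideanSpace.proj j : EuclideanSpace ℝ (Fin 3) →L[ℝ] ℝ).hasFDerivAt.comp y hw.hasFDerivAt).fderiv]
  have h1 : ‖(EuclideanSpace.proj j : EuclideanSpace ℝ (Fin 3) →L[ℝ] ℝ)‖ ≤ 1 :=
    ContinuousLinearMap.opNorm_le_bound _ zero_le_one fun v => by rw [one_mul]; exact PiLp.norm_apply_le v j
  calc _ ≤ ‖(EuclideanSpace.proj j : EuclideanSpace ℝ (Fin 3) →L[ℝ] ℝ)‖ * ‖fderiv ℝ w y‖ := ContinuousLinearMap.opNorm_comp_le _ _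
    _ ≤ 1 * ‖fderiv ℝ w y‖ := mul_le_mul_of_nonneg_right h1 (norm_nonneg _)
    _ = ‖fderiv ℝ w y‖ := one_mul _

/-- `‖∇(w_j)(y)‖ ≤ ‖Dw(y)‖` (the Riesz map is an isometry). [folklore] -/
theorem norm_gradient_coord_le {w : EuclideanSpace ℝ (Fin 3) → EuclideanSpace ℝ (Fin 3)} {y : EuclideanSpace ℝ (Fin 3)}
    (hw : DifferentiableAt ℝ w y) (j : Fin 3) :
    ‖gradient (fun z => w z j) y‖ ≤ ‖fderiv ℝ w y‖ := by
  rw [gradient, LinearIsometryEquiv.norm_map]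
  exact norm_fderiv_coord_le_opNorm hw j

/-- **`∫ div X = 0` from apex-weight majorants**: a `C¹` field `X` on `ℝ³` with `‖X‖ ≤ C/(‖y‖+a)⁴` and
`‖div X‖ ≤ C'/(‖y‖+a)⁵` (`a > 0`) has `div X ∈ L¹` and `∫ div X = 0`. [folklore] -/
theorem integral_divergence_eq_zero_of_apexWeight {X : EuclideanSpace ℝ (Fin 3) → EuclideanSpace ℝ (Fin 3)} (hX : ContDiff ℝ 1 X) {a C C' : ℝ} (ha : 0 < a)
    (hb : ∀ y, ‖X y‖ ≤ C / (‖y‖ + a) ^ 4) (hb' : ∀ y, ‖VectorCalculus.divergence X y‖ ≤ C' / (‖y‖ + a) ^ 5) :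
    Integrable (fun y => VectorCalculus.divergence X y) volume ∧ ∫ y, VectorCalculus.divergence X y = 0 := by
  have hi : Integrable X volume :=
    integrable_of_norm_le_apexWeight hX.continuous.aestronglyMeasurable ha le_rfl hb
  have hdi : Integrable (fun y => VectorCalculus.divergence X y) volume :=
    integrable_of_norm_le_apexWeight (contDiff_divergence (n := 0) (by simpa using hX)).continuous.aestronglyMeasurable
      ha (by norm_num) hb'
  exact ⟨hdi, integral_divergence_eq_zero_of_integrable hX hi hdi⟩

/-- Products of apex weights: `(A/ρᵖ)(B/ρ^q) = AB/ρ^{p+q}`. [folklore] -/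
theorem div_pow_mul_div_pow {ρ : ℝ} (A B : ℝ) (p q : ℕ) :
    A / ρ ^ p * (B / ρ ^ q) = A * B / ρ ^ (p + q) := by
  rw [div_mul_div_comm, pow_add]

end Divergence

/-! ### The slice integrals of the twins -/

section Twins

variable {V₁ V₂ : ℝ → EuclideanSpace ℝ (Fin 3) → EuclideanSpace ℝ (Fin 3)} {Q₁ Q₂ : ℝ → EuclideanSpace ℝ (Fin 3) → ℝ}

/-- **`∫ G_j(t, y) dy = 0`** for the defect source of the twins on every slice `t < 0` (and `G_j ∈ L¹`): each of
`div(∇w_j)`, `div((V₁)_j w)`, `div(w_j V₂)` integrates to zero. [folklore] -/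
theorem integral_defectSource_coord_eq_zero (hcl₁ : IsClassicalNSSolutionOn (Iio (0 : ℝ)) 1 0 V₁ Q₁)
    (hcl₂ : IsClassicalNSSolutionOn (Iio (0 : ℝ)) 1 0 V₂ Q₂) (hB₁ : ScaleInvariantBounds V₁ Q₁)
    (hB₂ : ScaleInvariantBounds V₂ Q₂) (hF : FarDecay 3 V₁ V₂) {t : ℝ} (ht : t < 0) (j : Fin 3) :
    Integrable (fun y => (Δ (fun z => V₁ t z - V₂ t z) y -
        (convect (fun z => V₁ t z - V₂ t z) (V₁ t) y + convect (V₂ t) (fun z => V₁ t z - V₂ t z) y)) j) volume ∧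
      ∫ y, (Δ (fun z => V₁ t z - V₂ t z) y -
        (convect (fun z => V₁ t z - V₂ t z) (V₁ t) y + convect (V₂ t) (fun z => V₁ t z - V₂ t z) y)) j = 0 := by
  obtain ⟨W, hW0, hW⟩ := exists_global_cubic_flatness hcl₁.smooth_velocity hcl₂.smooth_velocity hB₁ hB₂ hF 2
  obtain ⟨L, hL0, hL⟩ := exists_twin_velocity_bounds hB₁ hB₂ 1
  have hσ : 0 < Real.sqrt (-t) := Real.sqrt_pos.2 (by linarith)
  have hnt : 0 ≤ -t := by linarith
  set a : ℝ := Real.sqrt (-t) with ha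
  set w : EuclideanSpace ℝ (Fin 3) → EuclideanSpace ℝ (Fin 3) := fun z => V₁ t z - V₂ t z with hw_def
  have hV₁ : ContDiff ℝ ∞ (V₁ t) := hcl₁.contDiff_velocity ht
  have hV₂ : ContDiff ℝ ∞ (V₂ t) := hcl₂.contDiff_velocity ht
  have hw : ContDiff ℝ ∞ w := hV₁.sub hV₂
  have hwd : ∀ y, DifferentiableAt ℝ w y := fun y => hw.differentiable (by simp) y
  have hdivw : VectorCalculus.IsDivFree w := fun y => by
    rw [hw_def, divergence_sub_apply (hV₁.differentiable (by simp) y) (hV₂.differentiable (by simp) y),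
      hcl₁.divFree t ht y, hcl₂.divFree t ht y, sub_zero]
  -- pointwise bounds on the slice (`ρ = ‖y‖ + a`)
  have hw0 : ∀ y, ‖w y‖ ≤ W * (-t) / (‖y‖ + a) ^ 3 := fun y => by
    have h := hW 0 (by norm_num) t ht y; rwa [norm_iteratedFDeriv_zero] at h
  have hw1 : ∀ y, ‖fderiv ℝ w y‖ ≤ W * (-t) / (‖y‖ + a) ^ 4 := fun y => by
    have h := hW 1 (by norm_num) t ht y; rwa [← norm_iteratedFDeriv_fderiv, norm_iteratedFDeriv_zero] at h
  have hw2 : ∀ y, ‖iteratedFDeriv ℝ 2 w y‖ ≤ W * (-t) / (‖y‖ + a) ^ 5 := fun y => hW 2 le_rfl t ht y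
  have hU0 : ∀ y, ‖V₁ t y‖ ≤ L / (‖y‖ + a) ^ 1 ∧ ‖V₂ t y‖ ≤ L / (‖y‖ + a) ^ 1 := fun y => by
    have h := hL 0 (by norm_num) t ht y; simp only [norm_iteratedFDeriv_zero, add_zero] at h; exact h
  have hU1 : ∀ y, ‖fderiv ℝ (V₁ t) y‖ ≤ L / (‖y‖ + a) ^ 2 ∧ ‖fderiv ℝ (V₂ t) y‖ ≤ L / (‖y‖ + a) ^ 2 := fun y => by
    have h := hL 1 le_rfl t ht y
    simp only [← norm_iteratedFDeriv_fderiv, norm_iteratedFDeriv_zero] at h; exact h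
  have hρ : ∀ y : EuclideanSpace ℝ (Fin 3), 0 < ‖y‖ + a := fun y => by positivity
  have hcoord : ∀ (v : EuclideanSpace ℝ (Fin 3)) (k : Fin 3), ‖v k‖ ≤ ‖v‖ := fun v k => PiLp.norm_apply_le v k
  have hWt : 0 ≤ W * (-t) := mul_nonneg hW0 hnt
  -- the three fields and their divergences
  have hX₁ : ContDiff ℝ 1 (gradient fun z => w z j) :=
    ((InnerProductSpace.toDual ℝ (EuclideanSpace ℝ (Fin 3))).symm.contDiff.comp
      ((((EuclideanSpace.proj j : EuclideanSpace ℝ (Fin 3) →L[ℝ] ℝ).contDiff.comp hw).fderiv_right (m := ∞) le_rfl))).of_le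
      (by norm_cast)
  have hX₂ : ContDiff ℝ 1 fun z => (V₁ t z) j • w z :=
    (((EuclideanSpace.proj j : EuclideanSpace ℝ (Fin 3) →L[ℝ] ℝ).contDiff.comp hV₁).smul hw).of_le (by norm_cast)
  have hX₃ : ContDiff ℝ 1 fun z => (w z) j • V₂ t z :=
    (((EuclideanSpace.proj j : EuclideanSpace ℝ (Fin 3) →L[ℝ] ℝ).contDiff.comp hw).smul hV₂).of_le (by norm_cast)
  have h₁ := integral_divergence_eq_zero_of_apexWeight hX₁ hσ (fun y => (norm_gradient_coord_le (hwd y) j).trans (hw1 y))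
    (fun y => by
      rw [← laplacian_coord_eq_divergence_gradient hw j y]
      refine (hcoord _ j).trans ((norm_laplacian_le_three_mul w y).trans ?_)
      rw [mul_div_assoc]
      exact mul_le_mul_of_nonneg_left (hw2 y) (by norm_num))
  have h₂ := integral_divergence_eq_zero_of_apexWeight hX₂ hσ
    (fun y => by
      rw [norm_smul]
      refine (mul_le_mul (((hcoord _ j).trans (hU0 y).1)) (hw0 y) (norm_nonneg _)
        (div_nonneg hL0 (pow_nonneg (hρ y).le _))).trans (le_of_eq ?_)
      rw [div_pow_mul_div_pow])
    (fun y => by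
      rw [← convect_coord_eq_divergence_smul hw hV₁ hdivw j y, convect_apply]
      refine ((hcoord _ j).trans (ContinuousLinearMap.le_opNorm _ _)).trans ?_
      refine (mul_le_mul (hU1 y).1 (hw0 y) (norm_nonneg _) (div_nonneg hL0 (pow_nonneg (hρ y).le _))).trans
        (le_of_eq ?_)
      rw [div_pow_mul_div_pow])
  have h₃ := integral_divergence_eq_zero_of_apexWeight hX₃ hσ
    (fun y => by
      rw [norm_smul]
      refine (mul_le_mul (((hcoord _ j).trans (hw0 y))) (hU0 y).2 (norm_nonneg _)
        (div_nonneg hWt (pow_nonneg (hρ y).le _))).trans (le_of_eq ?_)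
      rw [div_pow_mul_div_pow])
    (fun y => by
      rw [← convect_coord_eq_divergence_smul' hw hV₂ (hcl₂.divFree t ht) j y, convect_apply]
      refine ((hcoord _ j).trans (ContinuousLinearMap.le_opNorm _ _)).trans ?_
      refine (mul_le_mul (hw1 y) (hU0 y).2 (norm_nonneg _) (div_nonneg hWt (pow_nonneg (hρ y).le _))).trans
        (le_of_eq ?_)
      rw [div_pow_mul_div_pow])
  -- assemble `G_j = div X₁ − div X₂ − div X₃`
  have e : (fun y => (Δ w y - (convect w (V₁ t) y + convect (V₂ t) w y)) j) = fun y =>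
      VectorCalculus.divergence (gradient fun z => w z j) y -
        VectorCalculus.divergence (fun z => (V₁ t z) j • w z) y -
          VectorCalculus.divergence (fun z => (w z) j • V₂ t z) y := by
    funext y
    rw [PiLp.sub_apply, PiLp.add_apply, laplacian_coord_eq_divergence_gradient hw j y,
      convect_coord_eq_divergence_smul hw hV₁ hdivw j y,
      convect_coord_eq_divergence_smul' hw hV₂ (hcl₂.divFree t ht) j y]
    ring
  rw [e]
  have h12 : Integrable (fun y => VectorCalculus.divergence (gradient fun z => w z j) y -
      VectorCalculus.divergence (fun z => (V₁ t z) j • w z) y) volume := h₁.1.sub h₂.1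
  refine ⟨h12.sub h₃.1, ?_⟩
  rw [integral_sub h12 h₃.1, integral_sub h₁.1 h₂.1, h₁.2, h₂.2, h₃.2]
  norm_num

/-- **The first moments of `A_ij[G(t)]` vanish**: for every slice `t < 0` and all `m, i, j`, the function
`y ↦ y_m A_ij[G(t)](y)` is integrable on `ℝ³` and `∫ y_m (∂ᵢG_j − ∂ⱼG_i)(t, y) dy = −δ_{mi}∫G_j + δ_{mj}∫G_i = 0`.
[folklore] -/
theorem integral_coord_mul_antisymGrad_defectSource (hcl₁ : IsClassicalNSSolutionOn (Iio (0 : ℝ)) 1 0 V₁ Q₁)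
    (hcl₂ : IsClassicalNSSolutionOn (Iio (0 : ℝ)) 1 0 V₂ Q₂) (hB₁ : ScaleInvariantBounds V₁ Q₁)
    (hB₂ : ScaleInvariantBounds V₂ Q₂) (hF : FarDecay 3 V₁ V₂) {t : ℝ} (ht : t < 0) (m i j : Fin 3) {C₀ C₁ : ℝ}
    (hC₀0 : 0 ≤ C₀) (hC₁0 : 0 ≤ C₁)
    (hC₀ : ∀ y : EuclideanSpace ℝ (Fin 3), ‖iteratedFDeriv ℝ 0 (fun y => Δ (fun z => V₁ t z - V₂ t z) y -
        (convect (fun z => V₁ t z - V₂ t z) (V₁ t) y + convect (V₂ t) (fun z => V₁ t z - V₂ t z) y)) y‖ ≤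
      C₀ * (-t) / (‖y‖ + Real.sqrt (-t)) ^ (5 + 0))
    (hC₁ : ∀ y : EuclideanSpace ℝ (Fin 3), ‖iteratedFDeriv ℝ 1 (fun y => Δ (fun z => V₁ t z - V₂ t z) y -
        (convect (fun z => V₁ t z - V₂ t z) (V₁ t) y + convect (V₂ t) (fun z => V₁ t z - V₂ t z) y)) y‖ ≤
      C₁ * (-t) / (‖y‖ + Real.sqrt (-t)) ^ (5 + 1)) :
    Integrable (fun y : EuclideanSpace ℝ (Fin 3) => y m *
        ((fderiv ℝ (fun y => Δ (fun z => V₁ t z - V₂ t z) y -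
            (convect (fun z => V₁ t z - V₂ t z) (V₁ t) y + convect (V₂ t) (fun z => V₁ t z - V₂ t z) y))
          y (EuclideanSpace.single i (1 : ℝ))) j -
        (fderiv ℝ (fun y => Δ (fun z => V₁ t z - V₂ t z) y -
            (convect (fun z => V₁ t z - V₂ t z) (V₁ t) y + convect (V₂ t) (fun z => V₁ t z - V₂ t z) y))
          y (EuclideanSpace.single j (1 : ℝ))) i)) volume ∧
      ∫ y : EuclideanSpace ℝ (Fin 3), y m *
        ((fderiv ℝ (fun y => Δ (fun z => V₁ t z - V₂ t z) y -
            (convect (fun z => V₁ t z - V₂ t z) (V₁ t) y + convect (V₂ t) (fun z => V₁ t z - V₂ t z) y))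
          y (EuclideanSpace.single i (1 : ℝ))) j -
        (fderiv ℝ (fun y => Δ (fun z => V₁ t z - V₂ t z) y -
            (convect (fun z => V₁ t z - V₂ t z) (V₁ t) y + convect (V₂ t) (fun z => V₁ t z - V₂ t z) y))
          y (EuclideanSpace.single j (1 : ℝ))) i) = 0 := by
  have hσ : 0 < Real.sqrt (-t) := Real.sqrt_pos.2 (by linarith)
  have hnt : 0 ≤ -t := by linarith
  set a : ℝ := Real.sqrt (-t) with ha
  set G : EuclideanSpace ℝ (Fin 3) → EuclideanSpace ℝ (Fin 3) := fun y => Δ (fun z => V₁ t z - V₂ t z) y -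
    (convect (fun z => V₁ t z - V₂ t z) (V₁ t) y + convect (V₂ t) (fun z => V₁ t z - V₂ t z) y) with hG_def
  have hG : ContDiff ℝ ∞ G := contDiff_defectSource ((hcl₁.contDiff_velocity ht).sub (hcl₂.contDiff_velocity ht))
    (hcl₁.contDiff_velocity ht) (hcl₂.contDiff_velocity ht)
  have hGd : ∀ y, DifferentiableAt ℝ G y := fun y => hG.differentiable (by simp) y
  have hGk : ∀ k : Fin 3, ContDiff ℝ ∞ fun y => G y k := fun k => (EuclideanSpace.proj k : EuclideanSpace ℝ (Fin 3) →L[ℝ] ℝ).contDiff.comp hG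
  have hG0 : ∀ y, ‖G y‖ ≤ C₀ * (-t) / (‖y‖ + a) ^ 5 := fun y => by
    have h := hC₀ y; rwa [norm_iteratedFDeriv_zero] at h
  have hG1 : ∀ y, ‖fderiv ℝ G y‖ ≤ C₁ * (-t) / (‖y‖ + a) ^ 6 := fun y => by
    have h := hC₁ y; rwa [← norm_iteratedFDeriv_fderiv, norm_iteratedFDeriv_zero] at h
  have hcoord : ∀ (v : EuclideanSpace ℝ (Fin 3)) (k : Fin 3), ‖v k‖ ≤ ‖v‖ := fun v k => PiLp.norm_apply_le v k
  have hym : ∀ y : EuclideanSpace ℝ (Fin 3), ‖y m‖ ≤ ‖y‖ := fun y => hcoord y m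
  -- the three integrability facts for each component
  have hint : ∀ k : Fin 3, Integrable (fun y => G y k) volume ∧ ∫ y, G y k = 0 := fun k =>
    integral_defectSource_coord_eq_zero hcl₁ hcl₂ hB₁ hB₂ hF ht k
  have hmk : ∀ k : Fin 3, Integrable (fun y : EuclideanSpace ℝ (Fin 3) => y m * G y k) volume := fun k => by
    refine integrable_of_norm_le_apexWeight (C := C₀ * (-t)) (p := 4)
      (((EuclideanSpace.proj m : EuclideanSpace ℝ (Fin 3) →L[ℝ] ℝ).continuous).mul (hGk k).continuous).aestronglyMeasurable hσ le_rfl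
      fun y => ?_
    rw [norm_mul]
    refine (mul_le_mul (hym y) ((hcoord _ k).trans (hG0 y)) (norm_nonneg _) (norm_nonneg _)).trans ?_
    exact norm_mul_div_apexWeight_succ_le hσ (mul_nonneg hC₀0 hnt) 4 y
  have hdk : ∀ k l : Fin 3, Integrable (fun y : EuclideanSpace ℝ (Fin 3) =>
      y m * fderiv ℝ (fun z => G z k) y (EuclideanSpace.single l (1 : ℝ))) volume := fun k l => by
    have hc : Continuous fun y : EuclideanSpace ℝ (Fin 3) => y m * fderiv ℝ (fun z => G z k) y (EuclideanSpace.single l (1 : ℝ)) :=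
      (EuclideanSpace.proj m : EuclideanSpace ℝ (Fin 3) →L[ℝ] ℝ).continuous.mul
        (((hGk k).continuous_fderiv (by simp)).clm_apply continuous_const)
    refine integrable_of_norm_le_apexWeight (C := C₁ * (-t)) (p := 5) hc.aestronglyMeasurable hσ (by norm_num)
      fun y => ?_
    rw [norm_mul]
    have h1 : ‖fderiv ℝ (fun z => G z k) y (EuclideanSpace.single l (1 : ℝ))‖ ≤ C₁ * (-t) / (‖y‖ + a) ^ 6 := by
      rw [← fderiv_apply_coord_eq (hGd y)]
      refine (hcoord _ k).trans ((ContinuousLinearMap.le_opNorm _ _).trans ?_)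
      rw [show ‖(EuclideanSpace.single l (1 : ℝ) : EuclideanSpace ℝ (Fin 3))‖ = 1 by simp, mul_one]
      exact hG1 y
    refine (mul_le_mul (hym y) h1 (norm_nonneg _) (norm_nonneg _)).trans ?_
    exact norm_mul_div_apexWeight_succ_le hσ (mul_nonneg hC₁0 hnt) 5 y
  -- `y_m A_ij[G] = y_m ∂ᵢG_j − y_m ∂ⱼG_i`
  have e : (fun y : EuclideanSpace ℝ (Fin 3) => y m * ((fderiv ℝ G y (EuclideanSpace.single i (1 : ℝ))) j - (fderiv ℝ G y (EuclideanSpace.single j (1 : ℝ))) i)) = fun y =>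
      y m * fderiv ℝ (fun z => G z j) y (EuclideanSpace.single i (1 : ℝ)) - y m * fderiv ℝ (fun z => G z i) y (EuclideanSpace.single j (1 : ℝ)) := by
    funext y
    rw [fderiv_apply_coord_eq (hGd y), fderiv_apply_coord_eq (hGd y), mul_sub]
  rw [e]
  refine ⟨(hdk j i).sub (hdk i j), ?_⟩
  rw [integral_sub (hdk j i) (hdk i j),
    integral_coord_mul_fderiv_apply ((hGk j).of_le (by norm_cast)) m i (hint j).1 (hmk j) (hdk j i),
    integral_coord_mul_fderiv_apply ((hGk i).of_le (by norm_cast)) m j (hint i).1 (hmk i) (hdk i j),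
    (hint j).2, (hint i).2]
  ring

end Twins

/-! ### Registered sub-goal -/

/-- **Registered helper stub `stub_vorticityDefectSliceTools`** of `stub_vorticityDefectDecay` (crux
stmt-NavierStokesRegularity-11717, line `moment-conditioned-rellich`): the slice identities of this file —
`∫ y_m ∂ᵢg = −δ_{mi}∫g` under `L¹` hypotheses, `∫ G_j(t) = 0` for the defect source of the twins, and
`∫ y_m A_ij[G(t)] = 0` given the global bounds on `G(t)` and `DG(t)`. [folklore] -/
theorem stub_vorticityDefectSliceTools :
    (∀ (g : EuclideanSpace ℝ (Fin 3) → ℝ) (m i : Fin 3), ContDiff ℝ 1 g → Integrable g volume →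
      Integrable (fun y : EuclideanSpace ℝ (Fin 3) => y m * g y) volume →
      Integrable (fun y : EuclideanSpace ℝ (Fin 3) => y m * fderiv ℝ g y (EuclideanSpace.single i (1 : ℝ))) volume →
      ∫ y : EuclideanSpace ℝ (Fin 3), y m * fderiv ℝ g y (EuclideanSpace.single i (1 : ℝ)) =
        -((EuclideanSpace.single i (1 : ℝ) : EuclideanSpace ℝ (Fin 3)) m * ∫ y, g y)) ∧
    (∀ (V₁ V₂ : ℝ → EuclideanSpace ℝ (Fin 3) → EuclideanSpace ℝ (Fin 3))
      (Q₁ Q₂ : ℝ → EuclideanSpace ℝ (Fin 3) → ℝ),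
      IsClassicalNSSolutionOn (Iio (0 : ℝ)) 1 0 V₁ Q₁ → IsClassicalNSSolutionOn (Iio (0 : ℝ)) 1 0 V₂ Q₂ →
      ScaleInvariantBounds V₁ Q₁ → ScaleInvariantBounds V₂ Q₂ → FarDecay 3 V₁ V₂ → ∀ t < 0,
      (∀ j : Fin 3, Integrable (fun y : EuclideanSpace ℝ (Fin 3) =>
            (fun y => Laplacian.laplacian (fun z => V₁ t z - V₂ t z) y -
              (convect (fun z => V₁ t z - V₂ t z) (V₁ t) y + convect (V₂ t) (fun z => V₁ t z - V₂ t z) y)) y j) volume ∧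
          ∫ y : EuclideanSpace ℝ (Fin 3),
            (fun y => Laplacian.laplacian (fun z => V₁ t z - V₂ t z) y -
              (convect (fun z => V₁ t z - V₂ t z) (V₁ t) y + convect (V₂ t) (fun z => V₁ t z - V₂ t z) y)) y j = 0) ∧
      (∀ (m i j : Fin 3) (C₀ C₁ : ℝ), 0 ≤ C₀ → 0 ≤ C₁ →
        (∀ y : EuclideanSpace ℝ (Fin 3), ‖iteratedFDeriv ℝ 0
            (fun y => Laplacian.laplacian (fun z => V₁ t z - V₂ t z) y -
              (convect (fun z => V₁ t z - V₂ t z) (V₁ t) y + convect (V₂ t) (fun z => V₁ t z - V₂ t z) y)) y‖ ≤ C₀ * (-t) / (‖y‖ + Real.sqrt (-t)) ^ (5 + 0)) →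
        (∀ y : EuclideanSpace ℝ (Fin 3), ‖iteratedFDeriv ℝ 1
            (fun y => Laplacian.laplacian (fun z => V₁ t z - V₂ t z) y -
              (convect (fun z => V₁ t z - V₂ t z) (V₁ t) y + convect (V₂ t) (fun z => V₁ t z - V₂ t z) y)) y‖ ≤ C₁ * (-t) / (‖y‖ + Real.sqrt (-t)) ^ (5 + 1)) →
        Integrable (fun y : EuclideanSpace ℝ (Fin 3) => y m *
          ((fderiv ℝ
              (fun y => Laplacian.laplacian (fun z => V₁ t z - V₂ t z) y -
                (convect (fun z => V₁ t z - V₂ t z) (V₁ t) y + convect (V₂ t) (fun z => V₁ t z - V₂ t z) y)) y (EuclideanSpace.single i (1 : ℝ))) j -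
            (fderiv ℝ
              (fun y => Laplacian.laplacian (fun z => V₁ t z - V₂ t z) y -
                (convect (fun z => V₁ t z - V₂ t z) (V₁ t) y + convect (V₂ t) (fun z => V₁ t z - V₂ t z) y)) y (EuclideanSpace.single j (1 : ℝ))) i)) volume ∧
        ∫ y : EuclideanSpace ℝ (Fin 3), y m *
          ((fderiv ℝ
              (fun y => Laplacian.laplacian (fun z => V₁ t z - V₂ t z) y -
                (convect (fun z => V₁ t z - V₂ t z) (V₁ t) y + convect (V₂ t) (fun z => V₁ t z - V₂ t z) y)) y (EuclideanSpace.single i (1 : ℝ))) j -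
            (fderiv ℝ
              (fun y => Laplacian.laplacian (fun z => V₁ t z - V₂ t z) y -
                (convect (fun z => V₁ t z - V₂ t z) (V₁ t) y + convect (V₂ t) (fun z => V₁ t z - V₂ t z) y)) y (EuclideanSpace.single j (1 : ℝ))) i) = 0)) :=
  ⟨fun _g m i hg hint hm hd => integral_coord_mul_fderiv_apply hg m i hint hm hd,
    fun _V₁ _V₂ _Q₁ _Q₂ hcl₁ hcl₂ hB₁ hB₂ hF _t ht =>
      ⟨fun j => integral_defectSource_coord_eq_zero hcl₁ hcl₂ hB₁ hB₂ hF ht j,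
        fun m i j _C₀ _C₁ hC₀0 hC₁0 hC₀ hC₁ =>
          integral_coord_mul_antisymGrad_defectSource hcl₁ hcl₂ hB₁ hB₂ hF ht m i j hC₀0 hC₁0 hC₀ hC₁⟩⟩

end Summit.NavierStokesRegularity.NavierStokesRegularity.Theorems.RellichScarScarRigidity

end
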